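import Mathlib
import Summits.Ventures.PercRepro2.UniversalTransport

/-! # (UH*) on every double bundle `B_m ∧ B_K` — the first infinite family beyond flow 2
(seat mine-b, cell pub-perc-repro2; MINE-B.md §23.13)

The configuration cube of two bundles of `m` and `K` free edges in series is `Finset (Fin m) × Finset (Fin K)`
(the sets of blue edges) with the labels `R (x, y) = min (m − |x|) (K − |y|)`, `B (x, y) = min |x| |y|`.  For
`m ≤ K` the universal level-conditioned Hall statement (UH*) has an EXPLICIT assignment:

* a source `(x, [K])` with `|x| ≤ m − 1` sends its slot `a ∈ x` to `(x ∖ {a}, [K] ∖ {a})` (`a < m ≤ K`);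
* a source `([m], y)` with `|y| ≤ K − 1` sends its slot `t < min m |y|` to `([m] ∖ {t}, y)`;
* the top `([m], [K])` sends its slot `k < m` to `([m] ∖ {m − 1}, [m] ∖ {k})` — the copies `t = m − 1` of the
  `(m − 1)`-subsets of `[m]` that the second rule leaves free.

Every target lies below its source, has red label exactly `1` and blue label `≥ demand − 1`, and the three images
are disjoint (first components of size `≤ m − 2`, `m − 1` with `t < m − 1` or `|y| ≥ m`, `m − 1` with `t = m − 1`);
inside each rule the target determines the slot.  `universal_doubleBundle` is the theorem on the abstract cube;
the instances `B₃ ∧ B₃`, `B₃ ∧ B₄`, `B₄ ∧ B₄`, `B₃ ∧ B₅` are also in the tree as kernel computations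
(UniversalB33 / UniversalSmall7 / UniversalSmall8A–C). -/

namespace Summit.Ventures.PercRepro2.UHClosure

open Finset

section doubleBundle

variable (m K : ℕ)

/-- the red label of the double bundle: `min (m − |x|) (K − |y|)` -/
def dbR (p : Finset (Fin m) × Finset (Fin K)) : ℕ := min (m - p.1.card) (K - p.2.card)

/-- the blue label of the double bundle: `min |x| |y|` -/
def dbB (p : Finset (Fin m) × Finset (Fin K)) : ℕ := min p.1.card p.2.card

variable {m K}

/-- a source has a full first or a full second component, and both components non-empty -/
lemma db_src {p : Finset (Fin m) × Finset (Fin K)} (h : USrc (dbR m K) (dbB m K) p) :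
    (p.1 = univ ∨ p.2 = univ) ∧ 1 ≤ p.1.card ∧ 1 ≤ p.2.card := by
  obtain ⟨h1, h2⟩ := h
  unfold dbR at h1; unfold dbB at h2
  have c1 := Finset.card_le_univ p.1; have c2 := Finset.card_le_univ p.2
  rw [Fintype.card_fin] at c1 c2
  refine ⟨?_, by omega, by omega⟩
  rcases Nat.eq_zero_or_pos (m - p.1.card) with h | h
  · left; exact (Finset.card_eq_iff_eq_univ p.1).1 (by rw [Fintype.card_fin]; omega)
  · right; exact (Finset.card_eq_iff_eq_univ p.2).1 (by rw [Fintype.card_fin]; omega)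

/-- the `i`-th element of a finset of `Fin m` (in increasing order) -/
def pickEl (x : Finset (Fin m)) (i : ℕ) (hi : i < x.card) : Fin m :=
  (x.sort (· ≤ ·))[i]'(by rw [Finset.length_sort]; exact hi)

/-- the picked element belongs to the finset -/
lemma pickEl_mem (x : Finset (Fin m)) (i : ℕ) (hi : i < x.card) : pickEl x i hi ∈ x := by
  unfold pickEl
  rw [← Finset.mem_sort (· ≤ ·)]
  exact List.getElem_mem _

/-- picking is injective in the index -/
lemma pickEl_inj (x : Finset (Fin m)) (i j : ℕ) (hi : i < x.card) (hj : j < x.card)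
    (he : pickEl x i hi = pickEl x j hj) : i = j := by
  unfold pickEl at he
  have hnd : (x.sort (· ≤ ·)).Nodup := Finset.sort_nodup _ _
  exact (List.Nodup.getElem_inj_iff hnd).1 he

variable (h : m ≤ K)

/-- the assignment: the three rules, by the shape of the source -/
noncomputable def dbAssign (q : SlotL (USrc (dbR m K) (dbB m K)) (dbB m K)) :
    Finset (Fin m) × Finset (Fin K) :=
  if hx : q.1.1.1.1 = univ then
    if hy : q.1.1.1.2 = univ then
      -- the top: slot `k` ↦ `([m] ∖ {m − 1}, [m] ∖ {k})`
      have hm : 0 < m := by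
        have := (db_src q.1.1.2.1).2.1; have := Finset.card_le_univ q.1.1.1.1; rw [Fintype.card_fin] at *; omega
      have hk : q.1.2.val < m := by
        have := q.2; unfold dbB at this
        have := Finset.card_le_univ q.1.1.1.1; rw [Fintype.card_fin] at *; omega
      (univ.erase ⟨m - 1, by omega⟩, (univ.erase (⟨q.1.2.val, hk⟩ : Fin m)).map (Fin.castLEEmb h))
    else
      -- `([m], y)`: slot `t` ↦ `([m] ∖ {t}, y)`
      have ht : q.1.2.val < m := by
        have := q.2; unfold dbB at this
        have := Finset.card_le_univ q.1.1.1.1; rw [Fintype.card_fin] at *; omega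
      (univ.erase (⟨q.1.2.val, ht⟩ : Fin m), q.1.1.1.2)
  else
    -- `(x, [K])`: slot `i` ↦ `(x ∖ {a}, [K] ∖ {a})` with `a` the `i`-th element of `x`
    have hi : q.1.2.val < q.1.1.1.1.card := by
      have := q.2; unfold dbB at this; omega
    (q.1.1.1.1.erase (pickEl q.1.1.1.1 q.1.2.val hi), univ.erase (Fin.castLE h (pickEl q.1.1.1.1 q.1.2.val hi)))

omit h in
/-- the first component of a source of the third kind is not full, so its card is `≤ m − 1` -/
lemma db_card_lt {x : Finset (Fin m)} (hx : x ≠ univ) : x.card < m := by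
  have := Finset.card_lt_card (Finset.ssubset_univ_iff.2 hx)
  rwa [Finset.card_univ, Fintype.card_fin] at this

omit h in
/-- the card of `univ.erase a` -/
lemma db_card_univ_erase (a : Fin m) : (univ.erase a).card = m - 1 := by
  rw [Finset.card_erase_of_mem (mem_univ a), Finset.card_univ, Fintype.card_fin]

/-- **the assignment is valid**: below the source, red label `1`, blue label `≥ demand − 1` -/
theorem dbAssign_spec (q : SlotL (USrc (dbR m K) (dbB m K)) (dbB m K)) :
    dbAssign h q ≤ q.1.1.1 ∧ dbR m K (dbAssign h q) = 1 ∧ dbB m K q.1.1.1 ≤ dbB m K (dbAssign h q) + 1 := by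
  obtain ⟨hfull, hc1, hc2⟩ := db_src q.1.1.2.1
  have hi := q.2; unfold dbB at hi
  have cm := Finset.card_le_univ q.1.1.1.1; have cK := Finset.card_le_univ q.1.1.1.2
  rw [Fintype.card_fin] at cm cK
  unfold dbAssign
  by_cases hx : q.1.1.1.1 = univ
  · by_cases hy : q.1.1.1.2 = univ
    · simp only [dif_pos hx, dif_pos hy]
      have e1 := db_card_univ_erase (m := m) ⟨m - 1, by omega⟩
      have e2 : ((univ.erase (⟨q.1.2.val, by omega⟩ : Fin m)).map (Fin.castLEEmb h)).card = m - 1 := by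
        rw [Finset.card_map, db_card_univ_erase]
      refine ⟨Prod.mk_le_mk.2 ⟨by rw [hx]; exact subset_univ _, by rw [hy]; exact subset_univ _⟩, ?_, ?_⟩
      · unfold dbR; dsimp only; rw [e1, e2]; omega
      · unfold dbB; dsimp only; rw [e1, e2]; omega
    · simp only [dif_pos hx, dif_neg hy]
      have e1 := db_card_univ_erase (m := m) ⟨q.1.2.val, by omega⟩
      have hyK := db_card_lt hy
      refine ⟨Prod.mk_le_mk.2 ⟨by rw [hx]; exact subset_univ _, le_rfl⟩, ?_, ?_⟩
      · unfold dbR; dsimp only; rw [e1]; omega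
      · unfold dbB; dsimp only; rw [e1]; omega
  · simp only [dif_neg hx]
    have hxm := db_card_lt hx
    have hy : q.1.1.1.2 = univ := by rcases hfull with h' | h' <;> [exact absurd h' hx; exact h']
    have hamem := pickEl_mem q.1.1.1.1 q.1.2.val (by omega)
    have e1 : (q.1.1.1.1.erase (pickEl q.1.1.1.1 q.1.2.val (by omega))).card = q.1.1.1.1.card - 1 :=
      Finset.card_erase_of_mem hamem
    have e2 := db_card_univ_erase (m := K) (Fin.castLE h (pickEl q.1.1.1.1 q.1.2.val (by omega)))
    refine ⟨Prod.mk_le_mk.2 ⟨Finset.erase_subset _ _, by rw [hy]; exact subset_univ _⟩, ?_, ?_⟩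
    · unfold dbR; dsimp only; rw [e1, e2]; omega
    · unfold dbB; dsimp only; rw [e1, e2]; omega

/-- **the assignment is injective** -/
theorem dbAssign_injective : Function.Injective (dbAssign h) := by
  intro q q' he
  obtain ⟨hfull, hc1, hc2⟩ := db_src q.1.1.2.1
  obtain ⟨hfull', hc1', hc2'⟩ := db_src q'.1.1.2.1
  have hi := q.2; have hi' := q'.2; unfold dbB at hi hi'
  have cm := Finset.card_le_univ q.1.1.1.1; have cK := Finset.card_le_univ q.1.1.1.2
  have cm' := Finset.card_le_univ q'.1.1.1.1; have cK' := Finset.card_le_univ q'.1.1.1.2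
  rw [Fintype.card_fin] at cm cK cm' cK'
  unfold dbAssign at he
  by_cases hx : q.1.1.1.1 = univ <;> by_cases hx' : q'.1.1.1.1 = univ
  · -- both first components full
    by_cases hy : q.1.1.1.2 = univ <;> by_cases hy' : q'.1.1.1.2 = univ
    · -- both the top: `[m] ∖ {k} = [m] ∖ {k'}`
      simp only [dif_pos hx, dif_pos hy, dif_pos hx', dif_pos hy'] at he
      have h2 := (Prod.mk.inj he).2
      have hk : q.1.2.val = q'.1.2.val := by
        have hinj := Finset.map_injective (Fin.castLEEmb h) h2
        have := (Finset.erase_inj univ (mem_univ (⟨q.1.2.val, by omega⟩ : Fin m))).1 hinj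
        exact Fin.mk.inj_iff.1 this
      exact slotL_ext q q' (Prod.ext (hx.trans hx'.symm) (hy.trans hy'.symm)) hk
    · -- top vs `([m], y')`: `[m] ∖ {k}` has `m − 1` elements, so `t' < m − 1`, but `t' = m − 1`
      exfalso
      simp only [dif_pos hx, dif_pos hy, dif_pos hx', dif_neg hy'] at he
      obtain ⟨h1, h2⟩ := Prod.mk.inj he
      have ht' : q'.1.2.val = m - 1 := by
        have := (Finset.erase_inj univ (mem_univ (⟨m - 1, by omega⟩ : Fin m))).1 h1
        exact (Fin.mk.inj_iff.1 this).symm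
      have hcard : q'.1.1.1.2.card = m - 1 := by
        rw [← h2, Finset.card_map, db_card_univ_erase]
      omega
    · exfalso
      simp only [dif_pos hx, dif_neg hy, dif_pos hx', dif_pos hy'] at he
      obtain ⟨h1, h2⟩ := Prod.mk.inj he
      have ht : q.1.2.val = m - 1 := by
        have := (Finset.erase_inj univ (mem_univ (⟨q.1.2.val, by omega⟩ : Fin m))).1 h1
        exact Fin.mk.inj_iff.1 this
      have hcard : q.1.1.1.2.card = m - 1 := by
        rw [h2, Finset.card_map, db_card_univ_erase]
      omega
    · -- both `([m], y)`: `y = y'` and `t = t'`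
      simp only [dif_pos hx, dif_neg hy, dif_pos hx', dif_neg hy'] at he
      obtain ⟨h1, h2⟩ := Prod.mk.inj he
      have ht : q.1.2.val = q'.1.2.val := by
        have := (Finset.erase_inj univ (mem_univ (⟨q.1.2.val, by omega⟩ : Fin m))).1 h1
        exact Fin.mk.inj_iff.1 this
      exact slotL_ext q q' (Prod.ext (hx.trans hx'.symm) h2) ht
  · -- first full, second of the third kind: cards of the first components differ
    exfalso
    have hxm' := db_card_lt hx'
    by_cases hy : q.1.1.1.2 = univ
    · simp only [dif_pos hx, dif_pos hy, dif_neg hx'] at he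
      have h1 := (Prod.mk.inj he).1
      have := congrArg Finset.card h1
      rw [db_card_univ_erase, Finset.card_erase_of_mem (pickEl_mem _ _ _)] at this
      omega
    · simp only [dif_pos hx, dif_neg hy, dif_neg hx'] at he
      have h1 := (Prod.mk.inj he).1
      have := congrArg Finset.card h1
      rw [db_card_univ_erase, Finset.card_erase_of_mem (pickEl_mem _ _ _)] at this
      omega
  · exfalso
    have hxm := db_card_lt hx
    by_cases hy' : q'.1.1.1.2 = univ
    · simp only [dif_neg hx, dif_pos hx', dif_pos hy'] at he
      have h1 := (Prod.mk.inj he).1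
      have := congrArg Finset.card h1
      rw [db_card_univ_erase, Finset.card_erase_of_mem (pickEl_mem _ _ _)] at this
      omega
    · simp only [dif_neg hx, dif_pos hx', dif_neg hy'] at he
      have h1 := (Prod.mk.inj he).1
      have := congrArg Finset.card h1
      rw [db_card_univ_erase, Finset.card_erase_of_mem (pickEl_mem _ _ _)] at this
      omega
  · -- both of the third kind: `a = a'`, then `x = x'`, then the index
    simp only [dif_neg hx, dif_neg hx'] at he
    obtain ⟨h1, h2⟩ := Prod.mk.inj he
    have hy : q.1.1.1.2 = univ := by rcases hfull with h' | h' <;> [exact absurd h' hx; exact h']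
    have hy' : q'.1.1.1.2 = univ := by rcases hfull' with h' | h' <;> [exact absurd h' hx'; exact h']
    have hamem : pickEl q.1.1.1.1 q.1.2.val (by omega) ∈ q.1.1.1.1 := pickEl_mem _ _ _
    have hamem' : pickEl q'.1.1.1.1 q'.1.2.val (by omega) ∈ q'.1.1.1.1 := pickEl_mem _ _ _
    have haa : pickEl q.1.1.1.1 q.1.2.val (by omega) = pickEl q'.1.1.1.1 q'.1.2.val (by omega) := by
      have := (Finset.erase_inj univ (mem_univ (Fin.castLE h (pickEl q.1.1.1.1 q.1.2.val (by omega))))).1 h2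
      exact Fin.castLE_injective h this
    have hxx : q.1.1.1.1 = q'.1.1.1.1 := by
      calc q.1.1.1.1 = insert (pickEl q.1.1.1.1 q.1.2.val (by omega)) (q.1.1.1.1.erase (pickEl q.1.1.1.1 q.1.2.val (by omega))) :=
            (Finset.insert_erase hamem).symm
        _ = insert (pickEl q'.1.1.1.1 q'.1.2.val (by omega)) (q'.1.1.1.1.erase (pickEl q'.1.1.1.1 q'.1.2.val (by omega))) := by
            rw [h1, haa]
        _ = q'.1.1.1.1 := Finset.insert_erase hamem'
    -- the index: the same element picked from the same finset
    have hidx : q.1.2.val = q'.1.2.val := by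
      have hl : q'.1.1.1.1.sort (· ≤ ·) = q.1.1.1.1.sort (· ≤ ·) := by rw [hxx]
      have e : pickEl q.1.1.1.1 q.1.2.val (by omega) = pickEl q.1.1.1.1 q'.1.2.val (by rw [hxx]; omega) := by
        rw [haa]; unfold pickEl
        exact List.getElem_of_eq hl _
      exact pickEl_inj _ _ _ _ _ e
    exact slotL_ext q q' (Prod.ext hxx (by rw [hy, hy'])) hidx

/-- **THEOREM: (UH*) holds on every double bundle `B_m ∧ B_K` with `m ≤ K`.** -/
theorem universal_doubleBundle (h : m ≤ K) : Universal (dbR m K) (dbB m K) :=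
  ⟨dbAssign h, dbAssign_injective h, dbAssign_spec h⟩

/-- the labels of `B_m ∧ B_K` are those of `B_K ∧ B_m` along the swap -/
lemma dbR_swap : dbR m K = dbR K m ∘ (OrderIso.prodComm : Finset (Fin K) × Finset (Fin m) ≃o _).symm := by
  funext p; obtain ⟨x, y⟩ := p
  exact min_comm _ _

/-- the labels of `B_m ∧ B_K` are those of `B_K ∧ B_m` along the swap -/
lemma dbB_swap : dbB m K = dbB K m ∘ (OrderIso.prodComm : Finset (Fin K) × Finset (Fin m) ≃o _).symm := by
  funext p; obtain ⟨x, y⟩ := p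
  exact min_comm _ _

/-- **THEOREM: (UH*) holds on every double bundle `B_m ∧ B_K`** (the case `K < m` by the symmetry of the factors). -/
theorem universal_doubleBundle' (m K : ℕ) : Universal (dbR m K) (dbB m K) := by
  rcases Nat.lt_or_ge K m with h | h
  · rw [dbR_swap, dbB_swap]
    exact universal_transport _ _ _ (universal_doubleBundle h.le)
  · exact universal_doubleBundle h

end doubleBundle

end Summit.Ventures.PercRepro2.UHClosure
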